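import Summits.ValiantsHypothesis.ValiantsHypothesis.Theorems.PolyaContinuedMonotoneCoverHardGradedCut

/-!
# Crux `MonotoneCoverHard` (stmt-ValiantsHypothesis-7421), line `few-state-cut`: the bet holds with
exponent `c = 2` for every GRADED cover

Second half of the graded-cover helper (val-width-7421-p2 g0, 2026-08-27); see the module docstring of
`PolyaContinuedMonotoneCoverHardGradedCut.lean` for the setting (level function `g`, one variable edge
per level, matchings determined by their variable edges — satisfied by every ABP / decision-tree cover,
i.e. by every label-bijective cover of `per_n` currently known).  Here the bookkeeping lemmas and the
entry/exit key lemma are assembled into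

* `exists_balanced_cut_card_le_sq_of_graded` — for `2 ≤ n` the layer cut at `h = ⌈n/2⌉` is balanced
  (`n ≤ 3h ≤ 2n`) and has at most `m * m` crossing states;
* `exists_balanced_cut_of_graded` — the same in the exact shape of the conclusion of the repaired stub
  `Cruxes.MonotoneCoverHard.FewStateCut.stub_fewStateCut`, with `c = 2` (`m * m ≤ 2^((log₂ m + 2)^2)`,
  `mul_self_le_two_pow_log_sq`).

The NON-graded case (perfect-matching families with independently flippable alternating cycles) is the
content of the bet and is untouched; VP ≠ VNP is not moved.  No definitions.
-/

namespace Summit.ValiantsHypothesis.ValiantsHypothesis.Theorems.PolyaContinuedMonotoneCoverHard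

-- summit = sub-problem name (single-conjunct summit, D-0017 layout), so the namespace repeats it
set_option linter.dupNamespace false

open scoped Classical
open Finset

variable {R : Type*} [CommSemiring R] {ι : Type*}

/-- **Graded covers have a balanced cut with at most `m²` states.**  Let `(E, a)` be a cover on
`m + m` vertices with a level function `g` (`hvar`, `hone`) such that every weight-nonzero perfect
matching has exactly one variable edge with row endpoint on each level `ℓ < n` (`hlev`) and is determined
by its variable edges (`hinj`).  If `2 ≤ n`, the layer cut at height `h = ⌈n/2⌉` is balanced — every
weight-nonzero perfect matching has exactly `h` variable edges inside it, and `n ≤ 3h ≤ 2n` — and the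
number of its crossing states is at most `m * m`.  (This is the precise form of "tight cuts of ABP /
decision-tree covers have `≤ m²` states"; for `n = 1` no balanced cut exists at all, cf.
`MonotoneCoverHard.Negative.stub_fewStateCut_false`.) -/
theorem exists_balanced_cut_card_le_sq_of_graded {m : ℕ} (n : ℕ) (hn : 2 ≤ n)
    (E : Finset (Fin m × Fin m)) (a : Fin m × Fin m → MvPolynomial ι R) (g : Fin m ⊕ Fin m → ℕ)
    (hvar : ∀ i j, (i, j) ∈ E → (∃ k, a (i, j) = MvPolynomial.X k) →
      g (Sum.inr j) = g (Sum.inl i) + 1)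
    (hone : ∀ i j, (i, j) ∈ E → a (i, j) ≠ 0 → (¬ ∃ k, a (i, j) = MvPolynomial.X k) →
      g (Sum.inr j) = g (Sum.inl i))
    (hlev : ∀ τ : Equiv.Perm (Fin m), (∀ i, (i, τ i) ∈ E ∧ a (i, τ i) ≠ 0) →
      ∀ ℓ, ℓ < n → ∃! i : Fin m, (∃ k, a (i, τ i) = MvPolynomial.X k) ∧ g (Sum.inl i) = ℓ)
    (hinj : ∀ τ τ' : Equiv.Perm (Fin m), (∀ i, (i, τ i) ∈ E ∧ a (i, τ i) ≠ 0) →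
      (∀ i, (i, τ' i) ∈ E ∧ a (i, τ' i) ≠ 0) →
      (∀ i, ((∃ k, a (i, τ i) = MvPolynomial.X k) ∨ (∃ k, a (i, τ' i) = MvPolynomial.X k)) →
        τ i = τ' i) → τ = τ') :
    ∃ S : Finset (Fin m ⊕ Fin m),
      (∀ τ : Equiv.Perm (Fin m), (∀ i, (i, τ i) ∈ E ∧ a (i, τ i) ≠ 0) →
        n ≤ 3 * (univ.filter fun i : Fin m =>
            Sum.inl i ∈ S ∧ Sum.inr (τ i) ∈ S ∧ ∃ j, a (i, τ i) = MvPolynomial.X j).card ∧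
        3 * (univ.filter fun i : Fin m =>
            Sum.inl i ∈ S ∧ Sum.inr (τ i) ∈ S ∧ ∃ j, a (i, τ i) = MvPolynomial.X j).card ≤ 2 * n) ∧
      ((univ.filter fun τ : Equiv.Perm (Fin m) => ∀ i, (i, τ i) ∈ E ∧ a (i, τ i) ≠ 0).image
          (fun τ : Equiv.Perm (Fin m) => (univ.filter fun i : Fin m =>
            (Sum.inl i ∈ S ∧ Sum.inr (τ i) ∉ S) ∨ (Sum.inl i ∉ S ∧ Sum.inr (τ i) ∈ S)).image
              fun i => (i, τ i))).card ≤ m * m := by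
  set h := (n + 1) / 2 with hh
  have h1 : 1 ≤ h := by omega
  have hhn : h < n := by omega
  have hbal : n ≤ 3 * h ∧ 3 * h ≤ 2 * n := by omega
  set S : Finset (Fin m ⊕ Fin m) := univ.filter fun x =>
    Sum.elim (fun i => g (Sum.inl i) < h) (fun j => g (Sum.inr j) ≤ h) x with hSdef
  have hSl : ∀ i, Sum.inl i ∈ S ↔ g (Sum.inl i) < h := fun i => by simp [hSdef]
  have hSr : ∀ j, Sum.inr j ∈ S ↔ g (Sum.inr j) ≤ h := fun j => by simp [hSdef]
  refine ⟨S, fun τ hτ => ?_, ?_⟩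
  · rw [inside_filter_eq_of_graded E a g h hvar S hSl hSr τ hτ,
      card_var_below_eq_of_graded n a g h hhn.le τ (hlev τ hτ)]
    exact hbal
  · set good := univ.filter fun τ : Equiv.Perm (Fin m) => ∀ i, (i, τ i) ∈ E ∧ a (i, τ i) ≠ 0
      with hgood
    have hmem : ∀ τ, τ ∈ good ↔ ∀ i, (i, τ i) ∈ E ∧ a (i, τ i) ≠ 0 := fun τ => by simp [hgood]
    -- the key: (row of the level-`h` variable edge, column of the level-`(h-1)` variable edge),
    -- packaged as a pair of singletons so that it is a total function of `τ`
    set K : Equiv.Perm (Fin m) → Finset (Fin m) × Finset (Fin m) := fun τ =>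
      ((univ.filter fun i : Fin m => (∃ k, a (i, τ i) = MvPolynomial.X k) ∧ g (Sum.inl i) = h),
        (univ.filter fun i : Fin m =>
          (∃ k, a (i, τ i) = MvPolynomial.X k) ∧ g (Sum.inl i) = h - 1).image τ) with hKdef
    set t : Finset (Finset (Fin m) × Finset (Fin m)) :=
      (univ : Finset (Fin m)).image (fun i => ({i} : Finset (Fin m))) ×ˢ
        (univ : Finset (Fin m)).image (fun i => ({i} : Finset (Fin m))) with htdef
    have ht : t.card ≤ m * m := by
      calc t.card = ((univ : Finset (Fin m)).image fun i => ({i} : Finset (Fin m))).card *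
            ((univ : Finset (Fin m)).image fun i => ({i} : Finset (Fin m))).card := card_product _ _
        _ ≤ (univ : Finset (Fin m)).card * (univ : Finset (Fin m)).card :=
            Nat.mul_le_mul card_image_le card_image_le
        _ = m * m := by simp
    have hKt : ∀ τ ∈ good, K τ ∈ t := by
      intro τ hτ
      rw [hmem] at hτ
      obtain ⟨r, ⟨hrv, hrg⟩, hru⟩ := hlev τ hτ h hhn
      obtain ⟨q, ⟨hqv, hqg⟩, hqu⟩ := hlev τ hτ (h - 1) (by omega)
      have e1 : (univ.filter fun i : Fin m =>
          (∃ k, a (i, τ i) = MvPolynomial.X k) ∧ g (Sum.inl i) = h) = {r} := by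
        ext i
        simp only [mem_filter, mem_univ, true_and, mem_singleton]
        exact ⟨fun hi => hru i hi, fun hi => hi ▸ ⟨hrv, hrg⟩⟩
      have e2 : (univ.filter fun i : Fin m =>
          (∃ k, a (i, τ i) = MvPolynomial.X k) ∧ g (Sum.inl i) = h - 1) = {q} := by
        ext i
        simp only [mem_filter, mem_univ, true_and, mem_singleton]
        exact ⟨fun hi => hqu i hi, fun hi => hi ▸ ⟨hqv, hqg⟩⟩
      simp only [hKdef, htdef, e1, e2, image_singleton, mem_product, mem_image, mem_univ, true_and]
      exact ⟨⟨r, rfl⟩, ⟨τ q, rfl⟩⟩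
    refine (card_image_le_of_factor good t K
      (fun τ : Equiv.Perm (Fin m) => (univ.filter fun i : Fin m =>
        (Sum.inl i ∈ S ∧ Sum.inr (τ i) ∉ S) ∨ (Sum.inl i ∉ S ∧ Sum.inr (τ i) ∈ S)).image
          fun i => (i, τ i)) hKt ?_).trans ht
    intro τ hτ τ' hτ' hK
    rw [hmem] at hτ hτ'
    rw [crossing_filter_eq_of_graded E a g h hvar hone S hSl hSr τ hτ,
      crossing_filter_eq_of_graded E a g h hvar hone S hSl hSr τ' hτ']
    exact crossing_eq_of_key_eq n E a g h h1 hhn hvar hone hlev hinj τ τ' hτ hτ'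
      (congrArg Prod.fst hK) (congrArg Prod.snd hK)

/-- Elementary: `m * m ≤ 2 ^ ((log₂ m + 2)^2)`. -/
theorem mul_self_le_two_pow_log_sq (m : ℕ) : m * m ≤ 2 ^ ((Nat.log 2 m + 2) ^ 2) := by
  have hm : m < 2 ^ (Nat.log 2 m + 1) := Nat.lt_pow_succ_log_self Nat.one_lt_two m
  have h1 : m * m ≤ 2 ^ (Nat.log 2 m + 1) * 2 ^ (Nat.log 2 m + 1) := Nat.mul_le_mul hm.le hm.le
  have h2 : (Nat.log 2 m + 1) + (Nat.log 2 m + 1) ≤ (Nat.log 2 m + 2) ^ 2 := by nlinarith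
  calc m * m ≤ 2 ^ (Nat.log 2 m + 1) * 2 ^ (Nat.log 2 m + 1) := h1
    _ = 2 ^ ((Nat.log 2 m + 1) + (Nat.log 2 m + 1)) := (pow_add _ _ _).symm
    _ ≤ 2 ^ ((Nat.log 2 m + 2) ^ 2) := Nat.pow_le_pow_right Nat.two_pos h2

/-- **The line's bet holds, with exponent `c = 2`, for every graded cover** — the conclusion of the
(repaired) stub `Cruxes.MonotoneCoverHard.FewStateCut.stub_fewStateCut` in its exact shape:
a balanced vertex cut whose number of crossing states is `≤ 2 ^ ((Nat.log 2 m + 2) ^ 2)`.  The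
Pfaffian signing and the identity `per_n = PM_E(a)` are not needed beyond what `hlev` / `hinj` retain of
them; what the bet must still supply is the NON-graded case. -/
theorem exists_balanced_cut_of_graded {m : ℕ} (n : ℕ) (hn : 2 ≤ n)
    (E : Finset (Fin m × Fin m)) (a : Fin m × Fin m → MvPolynomial ι R) (g : Fin m ⊕ Fin m → ℕ)
    (hvar : ∀ i j, (i, j) ∈ E → (∃ k, a (i, j) = MvPolynomial.X k) →
      g (Sum.inr j) = g (Sum.inl i) + 1)
    (hone : ∀ i j, (i, j) ∈ E → a (i, j) ≠ 0 → (¬ ∃ k, a (i, j) = MvPolynomial.X k) →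
      g (Sum.inr j) = g (Sum.inl i))
    (hlev : ∀ τ : Equiv.Perm (Fin m), (∀ i, (i, τ i) ∈ E ∧ a (i, τ i) ≠ 0) →
      ∀ ℓ, ℓ < n → ∃! i : Fin m, (∃ k, a (i, τ i) = MvPolynomial.X k) ∧ g (Sum.inl i) = ℓ)
    (hinj : ∀ τ τ' : Equiv.Perm (Fin m), (∀ i, (i, τ i) ∈ E ∧ a (i, τ i) ≠ 0) →
      (∀ i, (i, τ' i) ∈ E ∧ a (i, τ' i) ≠ 0) →
      (∀ i, ((∃ k, a (i, τ i) = MvPolynomial.X k) ∨ (∃ k, a (i, τ' i) = MvPolynomial.X k)) →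
        τ i = τ' i) → τ = τ') :
    ∃ S : Finset (Fin m ⊕ Fin m),
      (∀ τ : Equiv.Perm (Fin m), (∀ i, (i, τ i) ∈ E ∧ a (i, τ i) ≠ 0) →
        n ≤ 3 * (univ.filter fun i : Fin m =>
            Sum.inl i ∈ S ∧ Sum.inr (τ i) ∈ S ∧ ∃ j, a (i, τ i) = MvPolynomial.X j).card ∧
        3 * (univ.filter fun i : Fin m =>
            Sum.inl i ∈ S ∧ Sum.inr (τ i) ∈ S ∧ ∃ j, a (i, τ i) = MvPolynomial.X j).card ≤ 2 * n) ∧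
      ((univ.filter fun τ : Equiv.Perm (Fin m) => ∀ i, (i, τ i) ∈ E ∧ a (i, τ i) ≠ 0).image
          (fun τ : Equiv.Perm (Fin m) => (univ.filter fun i : Fin m =>
            (Sum.inl i ∈ S ∧ Sum.inr (τ i) ∉ S) ∨ (Sum.inl i ∉ S ∧ Sum.inr (τ i) ∈ S)).image
              fun i => (i, τ i))).card ≤ 2 ^ ((Nat.log 2 m + 2) ^ 2) := by
  obtain ⟨S, hbal, hcard⟩ := exists_balanced_cut_card_le_sq_of_graded n hn E a g hvar hone hlev hinj
  exact ⟨S, hbal, hcard.trans (mul_self_le_two_pow_log_sq m)⟩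

end Summit.ValiantsHypothesis.ValiantsHypothesis.Theorems.PolyaContinuedMonotoneCoverHard
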